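import Summits.BirchSwinnertonDyer.Rank1Residual.Partition
import Summits.BirchSwinnertonDyer.Rank1Residual.X12.CMIrreducible
import Literature.NumberTheory.EllipticCurves.Rank1Residual.X9NoEntry
import HarnessLib

set_option linter.dupNamespace false
set_option autoImplicit false

/-!
# Partition lemma — hyp part 4 / tree part 6: five KERNEL-EMPTY cell families and the refined grid
(`Summits/BirchSwinnertonDyer/BirchSwinnertonDyer/Theorems/Rank1ResidualPartitionEmptyCells.lean`)

HONEST FRAMING (cell `b2b-bsdres`, run/shared/lean/b2b/bsd-rank1-residual/, verbatim in every
file): the goal of the cell is to DELETE the COMBINATION-SHAPED residual classes of the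
Birch–Swinnerton-Dyer formula for ALL analytic-rank `≤ 1` elliptic curves over `ℚ` — "full BSD
formula for every rank `≤ 1` curve in class `C`" assembled STRICTLY from published theorems — so
that the rank-`≤ 1` remainder becomes exactly the CONSTRUCTION-SHAPED classes, which are TYPED
(missing-input `Prop`s), NOT attempted. This is not "finishing BSD". Prove what is provable now;
shrink each hard class to its core with data; no claim beyond stated classes.

Theorems only; nothing in parts 1–5 (`Partition/{Grid,Table,Rows,CellOf}.lean`, `Partition.lean`)
is edited (the table `Cell.classify` and the four constraints `Cell.consistent` are unchanged).
This addendum names five Boolean cell families that are EMPTY for every real pair `(E, p)` by a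
theorem ALREADY in the tree, proves the emptiness on `cellOf W p`, and records by `decide +kernel`
what the refined grid `consistent₂ := consistent ∧ ¬kernelEmpty` says about three verdicts:

* E1 `cm ∧ sst` — `Rank1Residual.not_semistable_of_hasCM` (Silverman ATAEC II.6.4 + Ogg);
* E2 `cm ∧ mult` — `Rank1Residual.not_mult_of_hasCM` (CM ⇒ potentially good reduction);
* E3 `cm ∧ p odd ∧ ¬cmRam ∧ red` — harvest-1's `X12.not_red_of_not_cmRamified` (p205402: a CM
  curve has irreducible `E[p]` at every odd prime unramified in the CM field);
* E4 `cm ∧ cmSplit ∧ cmRam` — definitional (`CMSplit` begins with `¬ p ∣ d_K`);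
* E5 `irr ∧ ¬surj ∧ sst` — x9's `Rank1Residual.not_semistable_of_irr_of_not_surj` (Serre 1972
  Prop. 21 i)).

Kernel consequences on the grid (`decide +kernel` over all 36 864 cells): (S1) a `consistent₂` cell
is classified X12 iff it is `cm ∧ r = 1 ∧ p odd ∧ ADDITIVE ∧ ¬cmSplit ∧ (cmRam ∨ irr)` — the
multiplicative, semistable and "odd unramified reducible" X12 cells are empty; (S2) a `consistent₂`
X11b cell with `sst` has `surj` (the withdrawn-C4 / F1 domain is surjective); (S3) a `consistent₂` X9
cell (either rank) has `¬sst`. Curve level: `cellOf_consistent₂`, `classify_cellOf_eq_X12_imp`,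
`surj_of_classX11b_of_semistable`. Counts of the emptied cells per verdict are in HOME/PARTITION.md §9
(two Python mirrors); no count is asserted here. Nothing is booked; labels unchanged; no named fact
is introduced; axioms standard. hyp seat GEN 10 (co-owner of the Partition duty with lit).
-/

/-! The cell-level declarations of §1–§2b are DOT-NOTATION EXTENSIONS of the tree structure
`Summit.BirchSwinnertonDyer.Rank1Residual.Cell` (Partition/Grid.lean, another directory), declared
with their absolute names (lean/CONVENTIONS.md §2); the curve-level theorems of §3 live in this
file's own namespace `Summit.BirchSwinnertonDyer.BirchSwinnertonDyer.Rank1Residual.Partition`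
(as parts 1–3 of hyp's second formalization, p200092 / p201294 / p201324). -/

namespace Summit.BirchSwinnertonDyer.Rank1Residual.Cell

variable (c : Cell)

/-! ## §1 The five kernel-empty families (Boolean, cell level) -/

/-- E1: `cm ∧ sst` (no CM curve over `ℚ` is semistable). [folklore] -/
def emptyCMSst : Bool := c.cm && c.sst
/-- E2: `cm ∧ mult(p)` (a CM curve has no multiplicative prime). [folklore] -/
def emptyCMMult : Bool := c.cm && c.mult
/-- E3: `cm ∧ p odd ∧ p ∤ d_K ∧ red(p)` (harvest-1: CM ⇒ irr at odd unramified `p`). [folklore] -/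
def emptyCMUnramRed : Bool := c.cm && c.odd && !c.cmRam && c.isRed
/-- E4: `cm ∧ cmSplit ∧ cmRam` (split and ramified exclude each other by definition). [folklore] -/
def emptyCMSplitRam : Bool := c.cm && c.cmSplit && c.cmRam
/-- E5: `irr(p) ∧ ¬surj(p) ∧ sst` (Serre 1972 Prop. 21 i): semistable + irreducible ⇒ surjective).
[folklore] -/
def emptySmallIrrSst : Bool := c.smallIrr && c.sst

/-- The cell lies in one of the five kernel-empty families. [folklore] -/
def kernelEmpty : Bool :=
  c.emptyCMSst || c.emptyCMMult || c.emptyCMUnramRed || c.emptyCMSplitRam || c.emptySmallIrrSst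

/-- The refined consistency predicate: the four constraints of part 1 and none of E1–E5. [folklore] -/
def consistent₂ : Bool := c.consistent && !c.kernelEmpty

/-- The X12 core shape: `cm ∧ r = 1 ∧ p odd ∧ additive ∧ ¬cmSplit ∧ (cmRam ∨ irr)`. [folklore] -/
def x12Core : Bool := c.cm && c.r1 && c.odd && c.addv && !c.cmSplit && (c.cmRam || c.irr)

/-- The table's verdict is X12, as a Boolean. [folklore] -/
def isX12 : Bool := decide (c.classify = .residual .X12)

/-- Specification S1: on `consistent₂` cells, verdict X12 ⟺ the X12 core shape. [folklore] -/
def x12CoreSpec : Bool := (c.consistent₂ && c.isX12) == (c.consistent₂ && c.x12Core)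

/-- Specification S2: a `consistent₂` X11b cell with `sst` is surjective. [folklore] -/
def x11bSstSurjSpec : Bool := !(c.consistent₂ && c.x11b && c.sst) || c.surj

/-- Specification S3: a `consistent₂` X9 cell (tree reading, either rank) is not semistable. [folklore] -/
def x9NotSstSpec : Bool := !(c.consistent₂ && c.x9) || !c.sst

/-! ## §2 The finite verification (`decide +kernel` over the 36 864 cells) -/

/-- Raw form of S1. [folklore] -/
theorem x12Core_spec_raw :
    ∀ (pk : PK) (red : RedK) (im : ImK) (bigIm : Bool) (rk : RK)
      (cm ram sst anom gvpar a3zero cmSplit cmRam : Bool),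
      (Cell.mk pk red im bigIm rk cm ram sst anom gvpar a3zero cmSplit cmRam).x12CoreSpec = true := by
  decide +kernel

/-- **S1.** On the refined grid the X12 verdict is exactly the core shape
`cm ∧ r = 1 ∧ p odd ∧ add(p) ∧ ¬cmSplit ∧ (cmRam ∨ irr)`: the multiplicative, the semistable and the
odd-unramified-reducible X12 cells are kernel-empty. [folklore] -/
theorem x12Core_spec (c : Cell) : (c.consistent₂ && c.isX12) = (c.consistent₂ && c.x12Core) := by
  obtain ⟨pk, red, im, bigIm, rk, cm, ram, sst, anom, gvpar, a3zero, cmSplit, cmRam⟩ := c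
  have h := x12Core_spec_raw pk red im bigIm rk cm ram sst anom gvpar a3zero cmSplit cmRam
  simpa only [x12CoreSpec, beq_iff_eq] using h

/-- S1, implication form. [folklore] -/
theorem x12Core_of_classify (c : Cell) (hc : c.consistent₂ = true)
    (h : c.classify = .residual .X12) : c.x12Core = true := by
  have hs := x12Core_spec c
  have hx : c.isX12 = true := by simpa [isX12] using h
  simpa [hc, hx] using hs.symm

/-- Raw form of S2. [folklore] -/
theorem x11bSstSurj_spec_raw :
    ∀ (pk : PK) (red : RedK) (im : ImK) (bigIm : Bool) (rk : RK)
      (cm ram sst anom gvpar a3zero cmSplit cmRam : Bool),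
      (Cell.mk pk red im bigIm rk cm ram sst anom gvpar a3zero cmSplit cmRam).x11bSstSurjSpec = true := by
  decide +kernel

/-- Cell form of S2. [folklore] -/
theorem x11bSstSurj_spec (c : Cell) : c.x11bSstSurjSpec = true := by
  obtain ⟨pk, red, im, bigIm, rk, cm, ram, sst, anom, gvpar, a3zero, cmSplit, cmRam⟩ := c
  exact x11bSstSurj_spec_raw pk red im bigIm rk cm ram sst anom gvpar a3zero cmSplit cmRam

/-- **S2.** A refined-consistent X11b cell with `sst` is surjective (the semistable part of X11b —
the withdrawn-C4 domain F1 — carries `surj(p)`). [folklore] -/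
theorem surj_of_x11b_of_sst (c : Cell) (hc : c.consistent₂ = true) (hx : c.x11b = true)
    (hs : c.sst = true) : c.surj = true := by
  have h := x11bSstSurj_spec c
  simpa [x11bSstSurjSpec, hc, hx, hs] using h

/-- Raw form of S3. [folklore] -/
theorem x9NotSst_spec_raw :
    ∀ (pk : PK) (red : RedK) (im : ImK) (bigIm : Bool) (rk : RK)
      (cm ram sst anom gvpar a3zero cmSplit cmRam : Bool),
      (Cell.mk pk red im bigIm rk cm ram sst anom gvpar a3zero cmSplit cmRam).x9NotSstSpec = true := by
  decide +kernel

/-- Cell form of S3. [folklore] -/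
theorem x9NotSst_spec (c : Cell) : c.x9NotSstSpec = true := by
  obtain ⟨pk, red, im, bigIm, rk, cm, ram, sst, anom, gvpar, a3zero, cmSplit, cmRam⟩ := c
  exact x9NotSst_spec_raw pk red im bigIm rk cm ram sst anom gvpar a3zero cmSplit cmRam

/-- **S3.** A refined-consistent X9 cell is not semistable, in either rank (the rank clause
`r = 1 → ¬sst` of X9 is automatic at cell level too). [folklore] -/
theorem sst_false_of_x9 (c : Cell) (hc : c.consistent₂ = true) (hx : c.x9 = true) :
    c.sst = false := by
  have h := x9NotSst_spec c
  simpa [x9NotSstSpec, hc, hx] using h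

/-- A witness that the refinement is proper: the cell `(p ≥ 5, mult, surj, r = 1, cm, …)` is
consistent for part 1 but kernel-empty (E2), and the table classifies it X12. [folklore] -/
theorem kernelEmpty_witness :
    (⟨.ge5, .mult, .surj, true, .one, true, false, false, false, false, false, false, true⟩ : Cell).consistent
      = true ∧
    (⟨.ge5, .mult, .surj, true, .one, true, false, false, false, false, false, false, true⟩ : Cell).kernelEmpty
      = true ∧
    (⟨.ge5, .mult, .surj, true, .one, true, false, false, false, false, false, false, true⟩ : Cell).classify
      = .residual .X12 := by
  decide


/-! ## §2b Census of the refined grid — two KERNEL COUNTS (the headline numbers only: each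
`decide +kernel` count is one pass over the 36 864 cells, ≈ 10 s on the farm; the per-family and
per-verdict table is certified OUTSIDE the tree by two engines — B: the Python mirror
`HOME/b2b-bsdres-hyp/hyp/partition2/emptycells_enum.py` over lit's `grid.py`; A′: the same tree
definitions evaluated by Lean (`census_eval.lean`, transcript there) — HOME/PARTITION.md §9) -/

/-- Sum over the three `p`-classes. [folklore] -/
def pkSum (f : PK → ℕ) : ℕ :=
  f .two + f .three + f .ge5
/-- Sum over the four reduction types. [folklore] -/
def redSum (f : RedK → ℕ) : ℕ :=
  f .goodOrd + f .goodSS + f .mult + f .addv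
/-- Sum over the three image types. [folklore] -/
def imSum (f : ImK → ℕ) : ℕ :=
  f .surj + f .smallIrr + f .red
/-- Sum over the two ranks. [folklore] -/
def rkSum (f : RK → ℕ) : ℕ := f .zero + f .one
/-- Sum over a Boolean coordinate. [folklore] -/
def boolSum (f : Bool → ℕ) : ℕ := f true + f false

/-- Number of grid cells satisfying `f`: the nested finite sum over all 13 coordinates (every
constructor of every coordinate listed, as in `PK.decidableForall` & co. of part 1). [folklore] -/
def count (f : Cell → Bool) : ℕ :=
  pkSum fun pk => redSum fun red => imSum fun im => boolSum fun bigIm => rkSum fun rk =>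
  boolSum fun cm => boolSum fun ram => boolSum fun sst => boolSum fun anom => boolSum fun gvpar =>
  boolSum fun a3zero => boolSum fun cmSplit => boolSum fun cmRam =>
    if f ⟨pk, red, im, bigIm, rk, cm, ram, sst, anom, gvpar, a3zero, cmSplit, cmRam⟩ then 1 else 0

/-- The table's verdict is `v`, as a Boolean. [folklore] -/
def hasVerdict (v : Verdict) : Bool := decide (c.classify = v)

/-- Calibration: 36 864 cells; 13 952 consistent (PARTITION.md §2.1, engine B) — now a kernel
count. [folklore] -/
theorem count_grid : count (fun _ => true) = 36864 ∧ count (·.consistent) = 13952 := by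
  constructor <;> decide +kernel

/-- **The refined grid has 8 272 cells; 5 680 consistent cells are kernel-empty.** [folklore] -/
theorem count_consistent₂ :
    count (·.consistent₂) = 8272 ∧ count (fun c => c.consistent && c.kernelEmpty) = 5680 := by
  constructor <;> decide +kernel

end Summit.BirchSwinnertonDyer.Rank1Residual.Cell

/-! ## §3 Real pairs never lie in a kernel-empty cell -/

namespace Summit.BirchSwinnertonDyer.BirchSwinnertonDyer.Rank1Residual.Partition

open WeierstrassCurve Literature.NumberTheory.EllipticCurves
  Literature.NumberTheory.EllipticCurves.Rank1Residual Summit.BirchSwinnertonDyer.Rank1Residual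

section Curve

open scoped Classical

variable (W : WeierstrassCurve ℚ) [W.IsElliptic] [W.IsGloballyMinimal] (p : ℕ) [Fact p.Prime]

/-- E1 on real pairs: `cm ⇒ ¬sst` (`not_semistable_of_hasCM`).
[cite: SilvermanATAEC1994, Thm. II.6.4 (PDF p. 148)] -/
theorem cellOf_emptyCMSst : (cellOf W p).emptyCMSst = false := by
  by_cases h : W.HasCM
  · simp [Cell.emptyCMSst, cellOf_sst_false_of_hasCM (p := p) h]
  · simp [Cell.emptyCMSst, (cellOf_cm_false W p).2 h]

/-- E2 on real pairs: `cm ⇒ ¬mult(p)` (`not_mult_of_hasCM`).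
[cite: SilvermanATAEC1994, Thm. II.6.4 (PDF p. 148)] -/
theorem cellOf_emptyCMMult : (cellOf W p).emptyCMMult = false := by
  by_cases h : W.HasCM
  · have hm : (cellOf W p).mult = false := by
      rw [Bool.eq_false_iff, ne_eq, cellOf_mult]
      exact not_mult_of_hasCM W h p
    simp [Cell.emptyCMMult, hm]
  · simp [Cell.emptyCMMult, (cellOf_cm_false W p).2 h]

/-- E3 on real pairs: `p odd ∧ p ∤ d_K ⇒ irr(p)` (harvest-1 `X12.not_red_of_not_cmRamified`).
[cite: Mazur1978, §6 Prop. 6.3 (1) (p. 153)] -/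
theorem cellOf_emptyCMUnramRed : (cellOf W p).emptyCMUnramRed = false := by
  by_cases h : p ≠ 2 ∧ ¬ CMRamified W p
  · have hr : (cellOf W p).isRed = false := by
      rw [Bool.eq_false_iff, ne_eq, cellOf_isRed]
      exact X12.not_red_of_not_cmRamified W p h.1 h.2
    simp [Cell.emptyCMUnramRed, hr]
  · rcases not_and_or.mp h with h2 | hr
    · have ho : (cellOf W p).odd = false := by
        rw [Bool.eq_false_iff, ne_eq, cellOf_odd]
        exact h2
      simp [Cell.emptyCMUnramRed, ho]
    · have hc : (cellOf W p).cmRam = true := (cellOf_cmRam W p).2 (not_not.mp hr)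
      simp [Cell.emptyCMUnramRed, hc]

/-- E4 on real pairs: `cmSplit ⇒ ¬cmRam` (first conjunct of `CMSplit`). [folklore] -/
theorem cellOf_emptyCMSplitRam : (cellOf W p).emptyCMSplitRam = false := by
  by_cases h : CMSplit W p
  · have hr : (cellOf W p).cmRam = false := by
      rw [Bool.eq_false_iff, ne_eq, cellOf_cmRam]
      exact h.1
    simp [Cell.emptyCMSplitRam, hr]
  · simp [Cell.emptyCMSplitRam, (cellOf_cmSplit_false W p).2 h]

/-- E5 on real pairs: `irr(p) ∧ ¬surj(p) ⇒ ¬sst` (`not_semistable_of_irr_of_not_surj`).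
[cite: Serre1972, §5.4 Prop. 21 i)] -/
theorem cellOf_emptySmallIrrSst : (cellOf W p).emptySmallIrrSst = false := by
  by_cases h : Irr W p ∧ ¬ Surj W p
  · have hs : (cellOf W p).sst = false :=
      (cellOf_sst_false W p).2 (not_semistable_of_irr_of_not_surj W p h.1 h.2)
    simp [Cell.emptySmallIrrSst, hs]
  · have hi : (cellOf W p).smallIrr = false := by
      rw [Bool.eq_false_iff, ne_eq, cellOf_smallIrr]
      exact h
    simp [Cell.emptySmallIrrSst, hi]

/-- **The cell of a real pair is never kernel-empty.** [folklore] -/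
theorem cellOf_kernelEmpty : (cellOf W p).kernelEmpty = false := by
  simp [Cell.kernelEmpty, cellOf_emptyCMSst, cellOf_emptyCMMult, cellOf_emptyCMUnramRed,
    cellOf_emptyCMSplitRam, cellOf_emptySmallIrrSst]

/-- **The cell of a real pair is refined-consistent** (part 1's four constraints + E1–E5). [folklore] -/
theorem cellOf_consistent₂ : (cellOf W p).consistent₂ = true := by
  simp [Cell.consistent₂, cellOf_consistent, cellOf_kernelEmpty]

/-- **Every pair the table sends to X12 is additive at `p`, at an odd prime not split in `K`, and
is either ramified in `K` or irreducible at `p`** (S1 transported to curves). [folklore] -/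
theorem classify_cellOf_eq_X12_imp (h : Cell.classify (cellOf W p) = .residual .X12) :
    W.HasCM ∧ Addv W p ∧ p ≠ 2 ∧ ¬ CMSplit W p ∧ (CMRamified W p ∨ Irr W p) := by
  have hx := Cell.x12Core_of_classify _ (cellOf_consistent₂ W p) h
  simp only [Cell.x12Core, Bool.and_eq_true, Bool.or_eq_true, Bool.not_eq_true'] at hx
  obtain ⟨⟨⟨⟨⟨hcm, -⟩, hodd⟩, hadd⟩, hsplit⟩, hram⟩ := hx
  refine ⟨(cellOf_cm W p).1 hcm, (cellOf_addv W p).1 hadd, (cellOf_odd W p).1 hodd,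
    (cellOf_cmSplit_false W p).1 hsplit, ?_⟩
  rcases hram with hram | hirr
  · exact Or.inl ((cellOf_cmRam W p).1 hram)
  · exact Or.inr ((cellOf_irr W p).1 hirr)

omit [W.IsGloballyMinimal] in
/-- **`cm ∧ ¬good(p) ⇒ add(p)`** (E2 at curve level: a CM curve with bad reduction at `p` is
additive there). [cite: SilvermanATAEC1994, Thm. II.6.4 (PDF p. 148)] -/
theorem addv_of_hasCM_of_not_good (hCM : W.HasCM) (hng : ¬ Good W p) : Addv W p :=
  ⟨hng, not_mult_of_hasCM W hCM p⟩

/-- **Class X11b ∧ semistable ⇒ surj(p)** (S2 at curve level, directly from Serre's Prop. 21 i)):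
on the semistable part of X11b the surjective-image divisibility (Kato–Rubin, tree fact A32) is
available as well as the (ram) one whenever a (ram) prime exists. [cite: Serre1972, §5.4 Prop. 21 i)] -/
theorem surj_of_classX11b_of_semistable (hX : ClassX11b W p) (hs : Semistable W) : Surj W p :=
  surj_of_irr_of_semistable W p hX.2.2.2 hs

end Curve

end Summit.BirchSwinnertonDyer.BirchSwinnertonDyer.Rank1Residual.Partition
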